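import Summits.CriticalPhenomena.PercolationContinuityZ3.Theorems.Transplant.SkelFrmBParamsFineSize
import Summits.CriticalPhenomena.PercolationContinuityZ3.Theorems.Transplant.SkelNegBParamsFineSize
import Summits.CriticalPhenomena.PercolationContinuityZ3.Theorems.Transplant.SkelFrmBParamsLFA
import Summits.CriticalPhenomena.PercolationContinuityZ3.Theorems.Transplant.SkelNegBParamsLFA
import Summits.CriticalPhenomena.PercolationContinuityZ3.Theorems.Transplant.SkelNegBParamsFineSizeA
import Summits.CriticalPhenomena.PercolationContinuityZ3.Theorems.Transplant.PlanarSkeletonFrmDefs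
import Summits.CriticalPhenomena.PercolationContinuityZ3.Theorems.Transplant.SkelPhiStepIDataNS
import HarnessLib

/-!
# N2 (frames-only node `SamePDropOfSkeletonFrm₁`, OPEN) params column over `PlanarSkeletonFrm` — (ζ″) ledger, shape (B′) of record ((R-14)):
# MECHANICAL PORT of N1's `SkelNegBParamsFineSizeA` — chain of record `NegB`, part FineSize-A — the (ζ′) twin of part FineSize (p28xxxx) at `A := Aof κ = 20·K`: THE TRUE
# SIZE OF THE (ζ′) MULTIPLIERS `m^A_i = ⌊modulus/L̂_i⌋` — **`M_L + 1 ≤ 23·(s₀ + 2)`**, **`M_L + 1 ≤ 11·(s₁ + 2)`** (`s_i = m^A_i − 1` the stub increments of `fcellsA`; NO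
# factor `K/40`: … (N1 title abridged; see `SkelNegBParamsFineSizeA`)
builds on p205010 (kernel theorem, internal audit signed; external expert review pending) — nothing in this file uses p205010; NOTHING is claimed about the
open node `SamePDropOfSkeletonFrm₁` (`SamePDropOfSkeletonNeg₁` is CLOSED in the tree and untouched by this file).
Status sentence (coordinator 2026-08-20T04:30Z): "θ(p_c) = 0 on ℤ^d, all d ≥ 2 — kernel-verified (Lean 4/Mathlib, standard axioms); internal adversarial
audit SIGNED 2026-08-20 04:29Z; external expert review pending."
Lane `prim-bschramm-*`, seat `prim-bschramm-stmt` (gen 19); helper file (`--supports stmt-CriticalPhenomena-4575 --as helper`); ledger HOME/prim-bschramm-stmt/FRM-PARAMS.md §9, (R-14).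
PORT RULES (HOME/prim-bschramm-stmt-g19/lean/port_frm.py, the tool of record per (R-14)): outer namespace `PlanarSkeletonNeg ↦ PlanarSkeletonFrm`, carrier binder
`(Φ : PlanarSkeletonFrm G)`, record binder `(D : Skelφ.StepI.DataNS V)` (the selectors travel IN the record, `SkelPhiStepIDataNS`); section variables INLINED into every
declaration header; inner namespaces (`Neg`/`NegB`/`KS`/…) and every short name KEPT so all cross-references resolve unchanged; declarations using no section variable are
NOT re-declared (N1's originals are referenced fully qualified). Mathematical content, proofs, docstrings and citations are N1's, verbatim, except where stated next.
SELECTORS IN THIS FILE ((R-14) condition of record — joint selection, `D.sN`'s first argument is the literal handed to `D.sM`): none (pure port; the pairs are read through their N1 names).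
N1 HEADER (kept for the reader):
helper file (`--supports stmt-CriticalPhenomena-4575 --as helper`); ledger HOME/prim-bschramm-stmt/NEG-PARAMS.md.
* §1 `modulus_lt_mA` (`modulus < (m^A_i + 1)·L̂_i`), `modulus_gt` (`n(ℓ−1) < modulus`); §2 **`true_size₀A`**, **`true_size₁A`**, **`s0A_ge`**, **`s1A_ge`**, `s0A_ge'`/`s1A_ge'`
  (today's shapes `6R′+11 ≤ s₀`, `14R′+27 ≤ s₁`), **`rA_ge`**.
[cite: MartineauTassion2017, §3.2 Lemma 3.5 (the equilibrium data), §4.3] [cite: KozmaNitzan2024, §4 pp. 25–26 (two-unit cells)]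
-/

noncomputable section

open scoped Classical

namespace Summit.CriticalPhenomena.PercolationContinuityZ3.Theorems.Transplant

namespace PlanarSkeletonFrm

namespace NegB

open Literature.Probability.Percolation Literature.Probability.LatticeModels SimpleGraph
open SkelConc (Consts)
open Neg
open TwoAxis.Para (modulus)

section SizeLevel

/-! ## §1 The raw bounds -/

/-- **The (ζ′) multipliers from above**: `modulus < (m^A₀ + 1)·L̂₀` and `modulus < (m^A₁ + 1)·L̂₁` (`m^A_i = ⌊modulus/L̂_i⌋`, `L̂_i ≥ 1`). [folklore] -/
theorem modulus_lt_mA (κ : Consts) {V : Type} [DecidableEq V] [Countable V] {G : SimpleGraph V} [G.LocallyFinite] (Φ : PlanarSkeletonFrm G) (t : V) (p : unitInterval) (D : Skelφ.StepI.DataNS V) (g : ℕ) (f : ℕ) (hN : EqNumL κ Φ t p D g f) :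
    modulus (nL κ Φ t p D g f) (hL κ Φ t p D g f) (vL κ Φ t p D g f) (vβL κ Φ t p D g f) <
        (m0A κ Φ t p D g f + 1) * Skelφ.NegPrm.L0hat (nL κ Φ t p D g f) (hL κ Φ t p D g f) (ℓL κ Φ t p D g f) (vL κ Φ t p D g f) ∧
      modulus (nL κ Φ t p D g f) (hL κ Φ t p D g f) (vL κ Φ t p D g f) (vβL κ Φ t p D g f) <
        (m1A κ Φ t p D g f + 1) * Skelφ.NegPrm.L1hat (nL κ Φ t p D g f) (hL κ Φ t p D g f) := by
  obtain ⟨hn1, hℓ1⟩ := one_le_of_eqNumL κ Φ t p D g f hN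
  have hL0 : (0 : ℤ) < Skelφ.NegPrm.L0hat (nL κ Φ t p D g f) (hL κ Φ t p D g f) (ℓL κ Φ t p D g f) (vL κ Φ t p D g f) := by
    have := one_le_L0 hn1 hℓ1 (hL κ Φ t p D g f) (vL κ Φ t p D g f)
    unfold Skelφ.NegPrm.L0hat; linarith
  have hL1 : (0 : ℤ) < Skelφ.NegPrm.L1hat (nL κ Φ t p D g f) (hL κ Φ t p D g f) := by
    unfold Skelφ.NegPrm.L1hat
    have : (1 : ℤ) ≤ nL κ Φ t p D g f := by exact_mod_cast hn1
    linarith [abs_nonneg (hL κ Φ t p D g f)]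
  obtain ⟨e0, e1⟩ := mA_eq κ Φ t p D g f
  rw [e0, e1]
  exact ⟨Int.lt_ediv_add_one_mul_self _ hL0, Int.lt_ediv_add_one_mul_self _ hL1⟩

/-- **`n·(ℓ − 1) < modulus`** (`modulus > nℓ − n`, `modulus_vβOf`). [folklore] -/
theorem modulus_gt (κ : Consts) {V : Type} [DecidableEq V] [Countable V] {G : SimpleGraph V} [G.LocallyFinite] (Φ : PlanarSkeletonFrm G) (t : V) (p : unitInterval) (D : Skelφ.StepI.DataNS V) (g : ℕ) (f : ℕ) (hN : EqNumL κ Φ t p D g f) :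
    (nL κ Φ t p D g f : ℤ) * ((ℓL κ Φ t p D g f : ℤ) - 1) < modulus (nL κ Φ t p D g f) (hL κ Φ t p D g f) (vL κ Φ t p D g f) (vβL κ Φ t p D g f) := by
  obtain ⟨hn1, -⟩ := one_le_of_eqNumL κ Φ t p D g f hN
  have h1 := (Skelφ.NegPrm.modulus_vβOf hn1 (hL κ Φ t p D g f) (ℓL κ Φ t p D g f) (vL κ Φ t p D g f)).1
  unfold vβL
  linarith

/-! ## §2 The true sizes -/

/-- **`M_L + 1 ≤ 23·(s₀ + 2)`**: the (ζ′) stub increment of axis `0` is at least `M_L/23` up to `2` (no factor `K/40`). [this work] -/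
theorem true_size₀A (κ : Consts) {V : Type} [DecidableEq V] [Countable V] {G : SimpleGraph V} [G.LocallyFinite] (Φ : PlanarSkeletonFrm G) (t : V) (p : unitInterval) (D : Skelφ.StepI.DataNS V) (g : ℕ) (f : ℕ) (hN : EqNumL κ Φ t p D g f) (hκ : (hL κ Φ t p D g f).natAbs ≤ 10 * nL κ Φ t p D g f) :
    (ML κ Φ t p D g : ℤ) + 1 ≤ 23 * ((((fcellsA κ Φ t p D g f).s 0 : ℕ) : ℤ) + 2) := by
  have hn := hN.n_le
  have hℓ := hN.ℓ_le
  have hlt := (modulus_lt_mA κ Φ t p D g f hN).1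
  have hLh := L0hat_le κ Φ t p D g f hN hκ
  have hDg := modulus_gt κ Φ t p D g f hN
  have hs : (((fcellsA κ Φ t p D g f).s 0 : ℕ) : ℤ) + 2 = m0A κ Φ t p D g f + 1 := by rw [(fcellsA_s_at κ Φ t p D g f hN).1]; unfold fm0A; ring
  rw [hs]
  have hm : (0 : ℤ) ≤ m0A κ Φ t p D g f + 1 := by linarith [(one_le_fmA_at κ Φ t p D g f hN).1, show fm0A κ Φ t p D g f = m0A κ Φ t p D g f - 1 from rfl]
  set Mv : ℤ := (ML κ Φ t p D g : ℤ) with hMv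
  set n : ℤ := (nL κ Φ t p D g f : ℤ)
  set ℓ : ℤ := (ℓL κ Φ t p D g f : ℤ)
  set L : ℤ := Skelφ.NegPrm.L0hat (nL κ Φ t p D g f) (hL κ Φ t p D g f) (ℓL κ Φ t p D g f) (vL κ Φ t p D g f)
  set X : ℤ := m0A κ Φ t p D g f + 1 with hX
  -- `n (ℓ−1) < modulus < X L ≤ X (ℓ + 21 n + 1)` and `Mv (ℓ + 21 n + 1) ≤ 23 n (ℓ − 1)`
  have h1 : n * (ℓ - 1) < X * L := lt_trans hDg hlt
  have h2 : X * L ≤ X * (ℓ + 21 * n + 1) := mul_le_mul_of_nonneg_left hLh hm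
  have h3 : Mv * (ℓ + 21 * n + 1) ≤ 23 * (n * (ℓ - 1)) := by nlinarith
  have hM0 : 0 ≤ Mv := by positivity
  by_contra hc
  push Not at hc
  -- `23 X < Mv + 1` i.e. `23 X ≤ Mv`: then `23 X (ℓ+21n+1) ≤ Mv (ℓ+21n+1) ≤ 23 n (ℓ−1) < 23 X L ≤ 23 X (ℓ+21n+1)`
  have hc' : 23 * X ≤ Mv := by linarith
  have hpos : 0 < ℓ + 21 * n + 1 := by linarith
  nlinarith [mul_le_mul_of_nonneg_right hc' hpos.le]

/-- **`M_L + 1 ≤ 11·(s₁ + 2)`**: the (ζ′) stub increment of axis `1` is at least `M_L/11` up to `2`. [this work] -/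
theorem true_size₁A (κ : Consts) {V : Type} [DecidableEq V] [Countable V] {G : SimpleGraph V} [G.LocallyFinite] (Φ : PlanarSkeletonFrm G) (t : V) (p : unitInterval) (D : Skelφ.StepI.DataNS V) (g : ℕ) (f : ℕ) (hN : EqNumL κ Φ t p D g f) (hκ : (hL κ Φ t p D g f).natAbs ≤ 10 * nL κ Φ t p D g f) :
    (ML κ Φ t p D g : ℤ) + 1 ≤ 11 * ((((fcellsA κ Φ t p D g f).s 1 : ℕ) : ℤ) + 2) := by
  have hn := hN.n_le
  have hℓ := hN.ℓ_le
  have hlt := (modulus_lt_mA κ Φ t p D g f hN).2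
  have hLh := L1hat_le κ Φ t p D g f hκ
  have hDg := modulus_gt κ Φ t p D g f hN
  have hs : (((fcellsA κ Φ t p D g f).s 1 : ℕ) : ℤ) + 2 = m1A κ Φ t p D g f + 1 := by rw [(fcellsA_s_at κ Φ t p D g f hN).2]; unfold fm1A; ring
  rw [hs]
  have hm : (0 : ℤ) ≤ m1A κ Φ t p D g f + 1 := by linarith [(one_le_fmA_at κ Φ t p D g f hN).2, show fm1A κ Φ t p D g f = m1A κ Φ t p D g f - 1 from rfl]
  set Mv : ℤ := (ML κ Φ t p D g : ℤ)
  set n : ℤ := (nL κ Φ t p D g f : ℤ)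
  set ℓ : ℤ := (ℓL κ Φ t p D g f : ℤ)
  set L : ℤ := Skelφ.NegPrm.L1hat (nL κ Φ t p D g f) (hL κ Φ t p D g f)
  set X : ℤ := m1A κ Φ t p D g f + 1 with hX
  have h1 : n * (ℓ - 1) < X * L := lt_trans hDg hlt
  have h2 : X * L ≤ X * (11 * n) := mul_le_mul_of_nonneg_left hLh hm
  have hM0 : 0 ≤ Mv := by positivity
  have hn0 : 0 < n := by linarith
  have h3 : n * Mv ≤ n * (ℓ - 1) := by nlinarith
  by_contra hc
  push Not at hc
  have hc' : 11 * X ≤ Mv := by linarith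
  nlinarith [mul_le_mul_of_nonneg_left hc' hn0.le]

/-- **`Kq·(6R′ + 11) ≤ s₀`** (true size of the (ζ′) axis-0 increment: `23 s₀ ≥ 160·Kq·(R′+2) − 45`). [this work] -/
theorem s0A_ge (κ : Consts) {V : Type} [DecidableEq V] [Countable V] {G : SimpleGraph V} [G.LocallyFinite] (Φ : PlanarSkeletonFrm G) (t : V) (p : unitInterval) (D : Skelφ.StepI.DataNS V) (g : ℕ) (f : ℕ) (hN : EqNumL κ Φ t p D g f) (hκ : (hL κ Φ t p D g f).natAbs ≤ 10 * nL κ Φ t p D g f) :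
    (Neg.Kq κ : ℤ) * (6 * (R' κ Φ t p D : ℤ) + 11) ≤ (((fcellsA κ Φ t p D g f).s 0 : ℕ) : ℤ) := by
  have h1 := true_size₀A κ Φ t p D g f hN hκ
  have h2 := coarse_floor_int κ Φ t p D g
  have hKq : (1 : ℤ) ≤ Neg.Kq κ := by exact_mod_cast Neg.one_le_Kq κ
  have hKe : (Neg.K κ : ℤ) = 40 * Neg.Kq κ := by rw [Neg.K_eq]; push_cast; ring
  have hR : (0 : ℤ) ≤ R' κ Φ t p D := by positivity
  rw [hKe] at h2
  nlinarith

/-- **`Kq·(14R′ + 27) ≤ s₁`** (true size of the (ζ′) axis-1 increment: `11 s₁ ≥ 160·Kq·(R′+2) − 21`). [this work] -/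
theorem s1A_ge (κ : Consts) {V : Type} [DecidableEq V] [Countable V] {G : SimpleGraph V} [G.LocallyFinite] (Φ : PlanarSkeletonFrm G) (t : V) (p : unitInterval) (D : Skelφ.StepI.DataNS V) (g : ℕ) (f : ℕ) (hN : EqNumL κ Φ t p D g f) (hκ : (hL κ Φ t p D g f).natAbs ≤ 10 * nL κ Φ t p D g f) :
    (Neg.Kq κ : ℤ) * (14 * (R' κ Φ t p D : ℤ) + 27) ≤ (((fcellsA κ Φ t p D g f).s 1 : ℕ) : ℤ) := by
  have h1 := true_size₁A κ Φ t p D g f hN hκ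
  have h2 := coarse_floor_int κ Φ t p D g
  have hKq : (1 : ℤ) ≤ Neg.Kq κ := by exact_mod_cast Neg.one_le_Kq κ
  have hKe : (Neg.K κ : ℤ) = 40 * Neg.Kq κ := by rw [Neg.K_eq]; push_cast; ring
  have hR : (0 : ℤ) ≤ R' κ Φ t p D := by positivity
  rw [hKe] at h2
  nlinarith

/-- Today's shapes (`Kq ≥ 1`): `6R′ + 11 ≤ s₀` and `14R′ + 27 ≤ s₁` for the (ζ′) cells. [folklore] -/
theorem sA_ge' (κ : Consts) {V : Type} [DecidableEq V] [Countable V] {G : SimpleGraph V} [G.LocallyFinite] (Φ : PlanarSkeletonFrm G) (t : V) (p : unitInterval) (D : Skelφ.StepI.DataNS V) (g : ℕ) (f : ℕ) (hN : EqNumL κ Φ t p D g f) (hκ : (hL κ Φ t p D g f).natAbs ≤ 10 * nL κ Φ t p D g f) :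
    6 * (R' κ Φ t p D : ℤ) + 11 ≤ (((fcellsA κ Φ t p D g f).s 0 : ℕ) : ℤ) ∧ 14 * (R' κ Φ t p D : ℤ) + 27 ≤ (((fcellsA κ Φ t p D g f).s 1 : ℕ) : ℤ) := by
  have h0 := s0A_ge κ Φ t p D g f hN hκ
  have h1 := s1A_ge κ Φ t p D g f hN hκ
  have hKq : (1 : ℤ) ≤ Neg.Kq κ := by exact_mod_cast Neg.one_le_Kq κ
  have hR : (0 : ℤ) ≤ R' κ Φ t p D := by positivity
  constructor <;> nlinarith

/-- **The units of record are large**: `K·Kq·(6R′+11) ≤ r₀` and `K·Kq·(14R′+27) ≤ r₁` (`r_i = K·s_i`). [this work] -/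
theorem rA_ge (κ : Consts) {V : Type} [DecidableEq V] [Countable V] {G : SimpleGraph V} [G.LocallyFinite] (Φ : PlanarSkeletonFrm G) (t : V) (p : unitInterval) (D : Skelφ.StepI.DataNS V) (g : ℕ) (f : ℕ) (hN : EqNumL κ Φ t p D g f) (hκ : (hL κ Φ t p D g f).natAbs ≤ 10 * nL κ Φ t p D g f) :
    (Neg.K κ : ℤ) * ((Neg.Kq κ : ℤ) * (6 * (R' κ Φ t p D : ℤ) + 11)) ≤ ((fcellsA κ Φ t p D g f).r 0 : ℤ) ∧
      (Neg.K κ : ℤ) * ((Neg.Kq κ : ℤ) * (14 * (R' κ Φ t p D : ℤ) + 27)) ≤ ((fcellsA κ Φ t p D g f).r 1 : ℤ) := by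
  have h0 := s0A_ge κ Φ t p D g f hN hκ
  have h1 := s1A_ge κ Φ t p D g f hN hκ
  have hK : (0 : ℤ) ≤ Neg.K κ := by positivity
  rw [(fcellsA κ Φ t p D g f).r_eq 0, (fcellsA κ Φ t p D g f).r_eq 1, (fcellsA_K κ Φ t p D g f).1]
  exact ⟨mul_le_mul_of_nonneg_left h0 hK, mul_le_mul_of_nonneg_left h1 hK⟩

end SizeLevel

end NegB

end PlanarSkeletonFrm

end Summit.CriticalPhenomena.PercolationContinuityZ3.Theorems.Transplant

end
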